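import Summits.CriticalPhenomena.PercolationContinuityZ3.Theorems.SahiMasterFamilyRigidityAllMain

/-!
# Rigidity at every order — the `(k−1)`-shared-coordinate detector is rigid for every `k`

Support file of the master-family programme (crux `NoHeavyLowerTail`, stmt-CriticalPhenomena-4575; cell `prim-masterthm`, seat P4,
unit `prim-masterthm-p4-g8`).  Seat document HOME/prim-masterthm-p4/RIGIDITY-ALLK.md §0 (Corollary) and §3.  Seventh file.

Let `U_0, U_1, …, U_{n+1}` be events with `U_0` `e`-free, increasing and nonempty, `U_1, …, U_{n+1}` increasing and `e` pivotal for each of them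
(`Piv_e U_j ≠ ∅`).  By `SharedCoordinate.exists_poly_sahiE_update`, `s ↦ E_{n+2}(μ_{p[e↦s]}; 1_U)` is a polynomial of degree `≤ n+1` whose top
coefficient is `(−1)^n [Σ_i E(1_{Piv_i}1_{U_0}) Π_{j≠i} E(1_{Piv_j}) − E(1_{U_0}) Π_j E(1_{Piv_j})]`.  Hence:
* `identity_of_forall_sahiE_eq_zero` — if `E_{n+2}(μ_p; 1_U) = 0` for every interior `p`, the pivotal sets `Q_j = Piv_e U_{j+1}` satisfy the
  rigidity identity `Σ_j μ_p(U_0 ∩ Q_j) Π_{l≠j} μ_p(Q_l) = μ_p(U_0) Π_l μ_p(Q_l)` at every interior `p`;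
* **`trivial_form_of_forall_sahiE_eq_zero`** (THEOREM R at every order, via `RigidityAll.rigidity_all`) — then exactly one pivotal set meets `U_0`,
  it shares no essential coordinate with `U_0`, and all other pivotal sets are disjoint from `U_0`;
* the DETECTORS **`exists_interior_sahiE_ne_zero_of_two_meet`** (two pivotal sets meeting `U_0` ⇒ `E_{n+2} ≢ 0`) and
  **`exists_interior_sahiE_ne_zero_of_shared`** (a pivotal set meeting `U_0` and sharing an essential coordinate with it ⇒ `E_{n+2} ≢ 0`);
  `n = 1` is gen-7's `TriangleDetector.exists_interior_sahiE_three_ne_zero_of_witness` (R₃), `n = 2` the conjectured R₄ of the `(T₄)` programme.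
HONEST FRAMING: criteria for NON-vanishing of `E_k`; Sahi `C_k` / Kahn's Conj. 5 / the master theorem remain OPEN.  [this work]
-/

noncomputable section

open scoped Classical
open Polynomial

namespace Summit.CriticalPhenomena.PercolationContinuityZ3.Theorems

open Finset Function
open Literature.Combinatorics.Sahi2008
open Literature.Probability.Percolation.DecisionTree (ind ind_of_mem ind_of_not_mem ind_nonneg)
open SharedCoordinate RigidityR3

namespace RigidityAll

variable {ι : Type*} [Fintype ι] {n : ℕ}

/-- **`E_{n+2} ≡ 0` on the open cube forces the rigidity identity for the pivotal sets at an `e`-free member.** [this work] -/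
theorem identity_of_forall_sahiE_eq_zero (U : Fin (n + 2) → Set (Set ι)) (e : ι) (hU0 : ∀ ω, insert e ω ∈ U 0 ↔ ω ∈ U 0)
    (hU : ∀ j : Fin (n + 1), IsUpperSet (U j.succ))
    (hzero : ∀ p : ι → unitInterval, (∀ i, (p i : ℝ) ∈ Set.Ioo (0 : ℝ) 1) → sahiE (bernoulliWeight p) (n + 2) (fun j => ind (U j)) = 0)
    (p : ι → unitInterval) (hp : ∀ i, (p i : ℝ) ∈ Set.Ioo (0 : ℝ) 1) :
    ∑ i : Fin (n + 1), ex (bernoulliWeight p) (ind (U 0 ∩ pivSet e (U i.succ))) *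
        ∏ j ∈ univ.erase i, ex (bernoulliWeight p) (ind (pivSet e (U j.succ))) =
      ex (bernoulliWeight p) (ind (U 0)) * ∏ j : Fin (n + 1), ex (bernoulliWeight p) (ind (pivSet e (U j.succ))) := by
  -- the polynomial in `s = p_e` vanishes at `n + 2` interior grid points, hence is zero, hence so is its top coefficient
  obtain ⟨Qp, _, hev, hcoeff⟩ := exists_poly_sahiE_update p e U hU0 hU
  have hQ : Qp = 0 := by
    refine eq_zero_of_natDegree_lt_card_of_eval_eq_zero Qp (gridPt_injective n) (fun m => ?_) (by rw [Fintype.card_fin]; omega)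
    rw [← hev]
    refine hzero _ fun i => ?_
    by_cases hi : i = e
    · subst hi; rw [update_self]; exact gridPt_mem_Ioo n m
    · rw [update_of_ne hi]; exact hp i
  rw [hQ, Polynomial.coeff_zero] at hcoeff
  have h := hcoeff.symm
  unfold topCoeff at h
  have hpow : ((-1 : ℝ) ^ n) ≠ 0 := pow_ne_zero _ (by norm_num)
  have h' := sub_eq_zero.1 ((mul_eq_zero.1 h).resolve_left hpow)
  -- translate the `e`-free expectations into expectations under `μ_p`
  have ig0 : Ignores e (ind (U 0)) := ignores_ind_of_forall_iff hU0
  have r1 : ∀ A : Set (Set ι), offEx p e (ind (pivSet e A)) = ex (bernoulliWeight p) (ind (pivSet e A)) :=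
    fun A => (ex_eq_offEx p e (ignores_ind_pivSet e A)).symm
  have r2 : ∀ A : Set (Set ι), offEx p e (ind (pivSet e A) * ind (U 0)) = ex (bernoulliWeight p) (ind (U 0 ∩ pivSet e A)) := by
    intro A
    rw [← ex_eq_offEx p e ((ignores_ind_pivSet e A).mul ig0), ind_inter_eq_mul, mul_comm]
  have r3 : offEx p e (ind (U 0)) = ex (bernoulliWeight p) (ind (U 0)) := (ex_eq_offEx p e ig0).symm
  simp only [r1, r2, r3] at h'
  exact h'

/-- **THEOREM R AT EVERY ORDER (the `(k−1)`-shared-coordinate detector is rigid).**  If `U_0` is `e`-free, increasing and nonempty, `U_1..U_{n+1}` are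
increasing with `e` pivotal for each, and `E_{n+2}(μ_p; 1_U) = 0` for every interior `p`, then exactly one pivotal set `Piv_e U_{j₀+1}` meets `U_0`,
it shares no essential coordinate with `U_0`, and every other pivotal set is disjoint from `U_0`. [this work] -/
theorem trivial_form_of_forall_sahiE_eq_zero (U : Fin (n + 2) → Set (Set ι)) (e : ι) (hU0 : ∀ ω, insert e ω ∈ U 0 ↔ ω ∈ U 0)
    (hU0up : IsUpperSet (U 0)) (hU0ne : (U 0).Nonempty) (hU : ∀ j : Fin (n + 1), IsUpperSet (U j.succ))
    (hpiv : ∀ j : Fin (n + 1), (pivSet e (U j.succ)).Nonempty)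
    (hzero : ∀ p : ι → unitInterval, (∀ i, (p i : ℝ) ∈ Set.Ioo (0 : ℝ) 1) → sahiE (bernoulliWeight p) (n + 2) (fun j => ind (U j)) = 0) :
    ∃ j₀ : Fin (n + 1), (pivSet e (U j₀.succ) ∩ U 0).Nonempty ∧ (∀ l : Fin (n + 1), l ≠ j₀ → pivSet e (U l.succ) ∩ U 0 = ∅) ∧
      ∀ y, Ignores y (ind (U 0)) ∨ Ignores y (ind (pivSet e (U j₀.succ))) := by
  obtain ⟨j₀, -, h1, h2, h3⟩ := rigidity_all (J := (univ : Finset (Fin (n + 1)))) (Q := fun j => pivSet e (U j.succ)) hU0up hU0ne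
    (fun j _ => hpiv j) (fun p hp => by convert identity_of_forall_sahiE_eq_zero U e hU0 hU hzero p hp)
  exact ⟨j₀, h1, fun l hl => h2 l (mem_univ l) hl, h3⟩

/-- **DETECTOR I: two pivotal sets meeting the `e`-free member force `E_{n+2} ≢ 0`.** [this work] -/
theorem exists_interior_sahiE_ne_zero_of_two_meet (U : Fin (n + 2) → Set (Set ι)) (e : ι) (hU0 : ∀ ω, insert e ω ∈ U 0 ↔ ω ∈ U 0)
    (hU0up : IsUpperSet (U 0)) (hU : ∀ j : Fin (n + 1), IsUpperSet (U j.succ)) (hpiv : ∀ j : Fin (n + 1), (pivSet e (U j.succ)).Nonempty)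
    {i₁ i₂ : Fin (n + 1)} (hne : i₁ ≠ i₂) (h₁ : (pivSet e (U i₁.succ) ∩ U 0).Nonempty) (h₂ : (pivSet e (U i₂.succ) ∩ U 0).Nonempty) :
    ∃ p : ι → unitInterval, (∀ i, (p i : ℝ) ∈ Set.Ioo (0 : ℝ) 1) ∧ sahiE (bernoulliWeight p) (n + 2) (fun j => ind (U j)) ≠ 0 := by
  by_contra hall
  push Not at hall
  have hU0ne : (U 0).Nonempty := by obtain ⟨ω, hω⟩ := h₁; exact ⟨ω, hω.2⟩
  obtain ⟨j₀, -, hoth, -⟩ := trivial_form_of_forall_sahiE_eq_zero U e hU0 hU0up hU0ne hU hpiv hall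
  by_cases hj : i₁ = j₀
  · exact (h₂.ne_empty) (hoth i₂ (fun h => hne (hj.trans h.symm)))
  · exact (h₁.ne_empty) (hoth i₁ hj)

/-- **DETECTOR II: a pivotal set meeting the `e`-free member and sharing an essential coordinate with it forces `E_{n+2} ≢ 0`.** [this work] -/
theorem exists_interior_sahiE_ne_zero_of_shared (U : Fin (n + 2) → Set (Set ι)) (e : ι) (hU0 : ∀ ω, insert e ω ∈ U 0 ↔ ω ∈ U 0)
    (hU0up : IsUpperSet (U 0)) (hU : ∀ j : Fin (n + 1), IsUpperSet (U j.succ)) (hpiv : ∀ j : Fin (n + 1), (pivSet e (U j.succ)).Nonempty)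
    {i₁ : Fin (n + 1)} (hmeet : (pivSet e (U i₁.succ) ∩ U 0).Nonempty)
    (hy : ∃ y, ¬ Ignores y (ind (pivSet e (U i₁.succ))) ∧ ¬ Ignores y (ind (U 0))) :
    ∃ p : ι → unitInterval, (∀ i, (p i : ℝ) ∈ Set.Ioo (0 : ℝ) 1) ∧ sahiE (bernoulliWeight p) (n + 2) (fun j => ind (U j)) ≠ 0 := by
  by_contra hall
  push Not at hall
  have hU0ne : (U 0).Nonempty := by obtain ⟨ω, hω⟩ := hmeet; exact ⟨ω, hω.2⟩
  obtain ⟨j₀, -, hoth, hor⟩ := trivial_form_of_forall_sahiE_eq_zero U e hU0 hU0up hU0ne hU hpiv hall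
  by_cases hj : i₁ = j₀
  · subst hj
    obtain ⟨y, hy1, hy0⟩ := hy
    exact (hor y).elim hy0 hy1
  · exact (hmeet.ne_empty) (hoth i₁ hj)

/-! ### The same at an arbitrary slot, in the vocabulary of `TerminalIff` -/

omit [Fintype ι] in
/-- A configuration at which `e` is pivotal (`e ∉ ω ∉ A ∋ ω ∪ {e}`) lies in the pivotal set. [this work] -/
theorem mem_pivSet_of_pivotal {e : ι} {A : Set (Set ι)} {ω : Set ι} (he : e ∉ ω) (hω : ω ∉ A) (hins : insert e ω ∈ A) : ω ∈ pivSet e A := by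
  refine ⟨mem_secAt.2 (by simpa [forceAt] using hins), fun h => hω ?_⟩
  have := mem_secAt.1 h
  simpa [forceAt, Set.sdiff_singleton_eq_self he] using this

omit [Fintype ι] in
/-- An increasing event not affected by `e` (Kahn's `Affects`) is `e`-free. [this work] -/
theorem insert_mem_iff_of_not_affects {e : ι} {A : Set (Set ι)} (hA : IsUpperSet A)
    (he : ¬ Literature.Probability.LatticeModels.Kahn2022.Affects A e) (ω : Set ι) : insert e ω ∈ A ↔ ω ∈ A :=
  ⟨fun h => by_contra fun hω => he ⟨ω, hω, h⟩, fun h => hA (Set.subset_insert e ω) h⟩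

/-- **THEOREM R at every order, at an arbitrary slot `i₀`** (reindexing by `sahiE_comp_perm`): `U i₀` `e`-free, increasing, nonempty; the other members
increasing with `e` pivotal; `E_{n+2} ≡ 0` on the open cube.  Then the pivotal sets of the other members are in trivial form w.r.t. `U i₀`. [this work] -/
theorem trivial_form_at (U : Fin (n + 2) → Set (Set ι)) (e : ι) (i₀ : Fin (n + 2)) (hU : ∀ j, IsUpperSet (U j))
    (he₀ : ∀ ω, insert e ω ∈ U i₀ ↔ ω ∈ U i₀) (hne : (U i₀).Nonempty)
    (hpiv : ∀ j : Fin (n + 1), (pivSet e (U (i₀.succAbove j))).Nonempty)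
    (hzero : ∀ p : ι → unitInterval, (∀ i, (p i : ℝ) ∈ Set.Ioo (0 : ℝ) 1) → sahiE (bernoulliWeight p) (n + 2) (fun j => ind (U j)) = 0) :
    ∃ j₀ : Fin (n + 1), (pivSet e (U (i₀.succAbove j₀)) ∩ U i₀).Nonempty ∧
      (∀ l : Fin (n + 1), l ≠ j₀ → pivSet e (U (i₀.succAbove l)) ∩ U i₀ = ∅) ∧
      ∀ y, Ignores y (ind (U i₀)) ∨ Ignores y (ind (pivSet e (U (i₀.succAbove j₀)))) := by
  -- reindex so that the free member sits in slot `0`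
  set σ : Equiv.Perm (Fin (n + 2)) := (finSuccEquiv (n + 1)).trans (finSuccEquiv' i₀).symm with hσ
  have hσ0 : σ 0 = i₀ := by simp [hσ, finSuccEquiv'_symm_none]
  have hσs : ∀ j : Fin (n + 1), σ j.succ = i₀.succAbove j := fun j => by simp [hσ, finSuccEquiv'_symm_some]
  set U' : Fin (n + 2) → Set (Set ι) := fun j => U (σ j) with hU'
  have h0 : U' 0 = U i₀ := by simp [hU', hσ0]
  have hs : ∀ j : Fin (n + 1), U' j.succ = U (i₀.succAbove j) := fun j => by simp [hU', hσs]
  have hzero' : ∀ p : ι → unitInterval, (∀ i, (p i : ℝ) ∈ Set.Ioo (0 : ℝ) 1) →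
      sahiE (bernoulliWeight p) (n + 2) (fun j => ind (U' j)) = 0 := by
    intro p hp
    have := sahiE_comp_perm (bernoulliWeight p) (n + 2) σ (fun j => ind (U j))
    rw [← hzero p hp, ← this]
  obtain ⟨j₀, h1, h2, h3⟩ := trivial_form_of_forall_sahiE_eq_zero U' e (by rw [h0]; exact he₀) (by rw [h0]; exact hU i₀)
    (by rw [h0]; exact hne) (fun j => by rw [hs]; exact hU _) (fun j => by rw [hs]; exact hpiv j) hzero'
  refine ⟨j₀, ?_, fun l hl => ?_, ?_⟩
  · rw [hs, h0] at h1; exact h1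
  · have := h2 l hl; rw [hs, h0] at this; exact this
  · rw [hs, h0] at h3; exact h3

end RigidityAll

end Summit.CriticalPhenomena.PercolationContinuityZ3.Theorems
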